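import Mathlib
import Summits.Ventures.HodgeRepro.Tier4.Target
import Summits.Ventures.HodgeRepro.Tier4.Line3.Defs
import Summits.Ventures.HodgeRepro.Tier4.Line3.DefsLemmas
import Summits.Ventures.HodgeRepro.Tier4.Line3.CoefMajorantWitness
import Summits.Ventures.HodgeRepro.Tier4.Line3.UnitCopyScaling

/-!
# Tier4/Line3/GaussRatioFormula — the Gaussian ratio of a per-slot scalar copy as an exponential of the definite sizes

Blind re-derivation cell `pub-hodge-repro`, Tier 4 «PROVE THE STEP», LINE L3, seat t4-L3-p2 (g2).  The `N`-free weight of a copy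
of the centre (`CopyData.weight`, CopyRemainder p682977) carries the factor `gaussRatio ε xm = ∏_j gaussDef (ε_j • xm_j) / gaussDef (xm_j)`
(UnitCopyScaling p680022).  This module writes it as `exp (−π · defSize ε xm)` with
`defSize ε x := Σ_j Σ_{σ definite} (‖σ(ε_j)‖² − 1) · |H_σ(σ x_j, σ x_j)|` — the quantity x2's archimedean count (S13519 (2)) estimates
with a large balanced centre: every definite size `|H_σ(xm_j)|` enters linearly, so the weight of a copy with `‖σ ε_j‖ > 1` at a
definite `σ` is exponentially small in that size.

Nothing here says anything about the status of the Hodge conjecture for CM abelian varieties, which is NOT proved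
(HC_CM is NOT proved by anyone in this repository).
-/

set_option autoImplicit false

noncomputable section

namespace Summit.Ventures.HodgeRepro.Tier4.Line3

open Summit.Ventures.HodgeRepro.Tier4
open Matrix NumberField
open scoped ComplexConjugate

namespace T4Data

variable (X : T4Data)

/-- The definite quadratic size of a vector at the embedding `σ`: `|H_σ(σ x, σ x)|`. -/
def defQuad (σ : X.E →+* ℂ) (x : Fin 3 → X.E) : ℝ :=
  |(star (fun i => σ (x i)) ⬝ᵥ ((X.H.map σ) *ᵥ (fun i => σ (x i)))).re|

/-- The definite quadratic size scales by `‖σ c‖²` under a scalar `c`. -/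
theorem defQuad_smul (σ : X.E →+* ℂ) (c : X.E) (x : Fin 3 → X.E) :
    X.defQuad σ (c • x) = ‖σ c‖ ^ 2 * X.defQuad σ x := by
  unfold defQuad
  have hv : (fun i => σ ((c • x) i)) = σ c • fun i => σ (x i) := by
    funext i
    simp [Pi.smul_apply, smul_eq_mul, map_mul]
  rw [hv, star_smul, Matrix.mulVec_smul, smul_dotProduct, dotProduct_smul, smul_eq_mul, smul_eq_mul, ← mul_assoc,
    Complex.star_def, Complex.conj_mul', ← Complex.ofReal_pow, Complex.re_ofReal_mul, abs_mul,
    abs_of_nonneg (by positivity : (0 : ℝ) ≤ ‖σ c‖ ^ 2)]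

open scoped Classical in
/-- `gaussDef` as the exponential of the sum of the definite sizes. -/
theorem gaussDef_eq_exp (x : Fin 3 → X.E) :
    X.gaussDef x = Real.exp (-(Real.pi *
      ∑ σ ∈ Finset.univ.filter (fun σ : X.E →+* ℂ => σ ≠ X.τ₀ ∧ σ ≠ conjEmb X.τ₀), X.defQuad σ x)) := by
  rw [X.gaussDef_eq_prod, Finset.mul_sum, ← Finset.sum_neg_distrib, Real.exp_sum]
  rfl

open scoped Classical in
/-- The sum of the definite sizes of the copy `ε • x`, relative to `x`. -/
def defSize (ε : Fin 4 → X.E) (x : X.Tuple) : ℝ :=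
  ∑ j, ∑ σ ∈ Finset.univ.filter (fun σ : X.E →+* ℂ => σ ≠ X.τ₀ ∧ σ ≠ conjEmb X.τ₀),
    (‖σ (ε j)‖ ^ 2 - 1) * X.defQuad σ (x j)

open scoped Classical in
/-- **THE GAUSSIAN RATIO AS AN EXPONENTIAL**: `gaussRatio ε x = exp (−π · defSize ε x)`. -/
theorem gaussRatio_eq_exp (ε : Fin 4 → X.E) (x : X.Tuple) :
    X.gaussRatio ε x = Real.exp (-(Real.pi * X.defSize ε x)) := by
  unfold gaussRatio defSize
  rw [Finset.mul_sum, ← Finset.sum_neg_distrib, Real.exp_sum]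
  refine Finset.prod_congr rfl fun j _ => ?_
  rw [X.gaussDef_eq_exp, X.gaussDef_eq_exp, ← Real.exp_sub, Finset.mul_sum, ← Finset.sum_neg_distrib, Finset.mul_sum,
    ← Finset.sum_neg_distrib, ← Finset.sum_sub_distrib, Finset.mul_sum, ← Finset.sum_neg_distrib]
  congr 1
  refine Finset.sum_congr rfl fun σ _ => ?_
  rw [X.defQuad_smul]
  ring

/-- The weight factor is at most `1` when no definite size decreases (`‖σ ε_j‖ ≥ 1` at every definite `σ`), and decays
exponentially in the definite sizes otherwise. -/
theorem gaussRatio_le_one_of_defSize_nonneg (ε : Fin 4 → X.E) (x : X.Tuple) (h : 0 ≤ X.defSize ε x) :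
    X.gaussRatio ε x ≤ 1 := by
  rw [X.gaussRatio_eq_exp]
  exact Real.exp_le_one_iff.2 (by nlinarith [Real.pi_pos])

end T4Data

end Summit.Ventures.HodgeRepro.Tier4.Line3

end
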